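import Mathlib
import Literature.NumberTheory.LFunctions.Zhang2022.KnifeEdgeInvisibleTailFamily

/-!
# The invisible tail sees only the block: jumps at or below `P^{1+ε}` do not escape it (§D typed delta, edge len)

Companion to `KnifeEdgeInvisibleTailFamily.lean` (`KnifeEdgeInvisibleTail.tailInvisible`, p446031).  That theorem is
stated for profiles `g` that are GLOBALLY `1`-Lipschitz with `‖g‖ ≤ 1`; but its conclusion concerns only the block
`P^{1+ε} ≤ X < n ≤ Y ≤ P^{1+δ}`, on which the profile is sampled at `z = log n / log P ≥ 1 + ε`.  Hence
(`tailInvisible_of_lipschitzOnWith`) the same bound holds for every profile that is `1`-Lipschitz and bounded by `1`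
on `[1+ε, ∞)` ONLY — whatever it does at or below the wall `z = 1` (jumps at the wall, jumps inside the band
`(1, 1+ε)`, unbounded variation there): replace `g` by `z ↦ g(max z (1+ε))`, globally `1`-Lipschitz, equal to `g` on
the block.  Second (`band_lt_rpow_one_add`): for every fixed `ε > 0`, eventually `P·(D·t₀) < P^{1+ε}` — the band
`(P, P·Dt₀] = (P, P^{1+α̃}]`, `α̃ = log(Dt₀)/log P → 0` (`Skeleton.alphaTilde`), lies below every invisibility
threshold.  Reading for the programme's edge len (cell landau-siegel §D, OBJECTIVE (O1)): a non-smooth coefficient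
class escapes the four KnifeEdge theorems only through the layer `P ≤ n ≤ P^{1+o(1)}`, never through its behaviour
beyond `P^{1+ε}`.  WHAT THIS IS NOT: a claim about Theorems 1–2 of arXiv:2211.02515, about Landau–Siegel zeros, or
about Parity; both statements are elementary (a Lipschitz extension; `𝓛 + 519 log 𝓛 < ε𝓛⁹`).
-/

namespace Literature.NumberTheory.LFunctions.Zhang2022.KnifeEdgeInvisibleTail

open Finset Skeleton

section Block

/-- `⌈exp L₀⌉ ≤ D` gives `L₀ ≤ 𝓛 = log D`. [folklore] -/
private theorem le_ell_of_ceil_exp_le'' {L₀ : ℝ} {D : ℕ} (hD : ⌈Real.exp L₀⌉₊ ≤ D) : L₀ ≤ ell D := by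
  have h : Real.exp L₀ ≤ (D : ℝ) := (Nat.le_ceil _).trans (by exact_mod_cast hD)
  exact (Real.le_log_iff_exp_le (lt_of_lt_of_le (Real.exp_pos _) h)).mpr h

/-- **The invisible tail needs the profile only on the block.** For `0 < ε`, `0 < δ` there is `C > 0` such that for
all large `D`, every primitive quadratic `χ (mod D)`, every `x = (p, ψ) ∈ Ψ`, every profile `g` that is `1`-Lipschitz
on `[1+ε, ∞)` with `‖g(z)‖ ≤ 1` there (NO hypothesis at or below the wall `z = 1`: jumps allowed), every `s` with
`½ − 1/log P ≤ Re s ≤ 2`, `|Im s| ≤ 8t₀`, and every block `P^{1+ε} ≤ X ≤ Y ≤ P^{1+δ}`: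
`‖Σ_{X<n≤Y} χψ(n) g(log n/log P) n^{−s}‖ ≤ C·P^{−ε/4}` — the constant of `tailInvisible`.  Proof: apply
`tailInvisible` to `z ↦ g(max z (1+ε))` and note `log n/log P ≥ 1+ε` on the block.
[cite: MontgomeryVaughan2007, Thm 9.18] [cite: Zhang2022LandauSiegel, §4 p. 8; §7 (7.2)] -/
theorem tailInvisible_of_lipschitzOnWith {δ ε : ℝ} (hε : 0 < ε) (hδ : 0 < δ) :
    ∃ C : ℝ, 0 < C ∧ Skeleton.ForAllLarge fun D _ χ =>
      ∀ (x : Skeleton.Chr D) (g : ℝ → ℂ), LipschitzOnWith 1 g (Set.Ici (1 + ε)) →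
        (∀ z : ℝ, 1 + ε ≤ z → ‖g z‖ ≤ 1) →
        ∀ s : ℂ, 1 / 2 - 1 / Real.log (Skeleton.bigP D) ≤ s.re → s.re ≤ 2 → |s.im| ≤ 8 * Skeleton.t0 D →
          ∀ X Y : ℕ, Skeleton.bigP D ^ (1 + ε) ≤ (X : ℝ) → X ≤ Y → (Y : ℝ) ≤ Skeleton.bigP D ^ (1 + δ) →
            ‖∑ n ∈ Finset.Ioc X Y, Skeleton.pc χ x n * g (Real.log n / Real.log (Skeleton.bigP D)) *
                (n : ℂ) ^ (-s)‖ ≤ C * Skeleton.bigP D ^ (-(ε / 4)) := by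
  obtain ⟨C, hC, D₁, hT⟩ := tailInvisible hε hδ
  refine ⟨C, hC, max D₁ 3, ?_⟩
  intro D _ χ hD hquad hprim x g hg hg1 s hσ1 hσ2 hsim X Y hX hXY hY
  -- the global 1-Lipschitz modification of `g` that agrees with it on `[1+ε, ∞)`
  set a : ℝ := 1 + ε with ha
  set gt : ℝ → ℂ := fun z => g (max z a) with hgt
  have hgt_lip : LipschitzWith 1 gt := by
    refine LipschitzWith.mk_one fun z₁ z₂ => ?_
    have h1 : dist (max z₁ a) (max z₂ a) ≤ dist z₁ z₂ := by
      have := lipschitzWith_iff_dist_le_mul.mp (LipschitzWith.id.max_const a) z₁ z₂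
      simpa using this
    have h2 := lipschitzOnWith_iff_dist_le_mul.mp hg (max z₁ a) (Set.mem_Ici.mpr (le_max_right _ _))
      (max z₂ a) (Set.mem_Ici.mpr (le_max_right _ _))
    calc dist (gt z₁) (gt z₂) = dist (g (max z₁ a)) (g (max z₂ a)) := rfl
      _ ≤ (1 : NNReal) * dist (max z₁ a) (max z₂ a) := h2
      _ ≤ dist z₁ z₂ := by rw [NNReal.coe_one, one_mul]; exact h1
  have hgt1 : ∀ z, ‖gt z‖ ≤ 1 := fun z => hg1 _ (le_max_right _ _)
  have key := hT D χ (le_trans (le_max_left _ _) hD) hquad hprim x gt hgt_lip hgt1 s hσ1 hσ2 hsim X Y hX hXY hY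
  -- on the block, `log n / log P ≥ 1 + ε`, so `gt = g` there
  have hD3 : (3 : ℝ) ≤ D := by exact_mod_cast le_trans (le_max_right _ _) hD
  have hℓ0 : 0 < ell D := Real.log_pos (by linarith)
  have hP : 0 < bigP D := Real.exp_pos _
  have hlogP : 0 < Real.log (bigP D) := by rw [bigP, Real.log_exp]; positivity
  have hsum : ∑ n ∈ Finset.Ioc X Y, pc χ x n * g (Real.log n / Real.log (bigP D)) * (n : ℂ) ^ (-s)
      = ∑ n ∈ Finset.Ioc X Y, pc χ x n * gt (Real.log n / Real.log (bigP D)) * (n : ℂ) ^ (-s) := by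
    refine Finset.sum_congr rfl fun n hn => ?_
    have hnX : X < n := (Finset.mem_Ioc.mp hn).1
    have hPn : bigP D ^ a ≤ (n : ℝ) := hX.trans (by exact_mod_cast hnX.le)
    have hz : a ≤ Real.log n / Real.log (bigP D) := by
      rw [le_div_iff₀ hlogP]
      calc a * Real.log (bigP D) = Real.log (bigP D ^ a) := (Real.log_rpow hP a).symm
        _ ≤ Real.log n := Real.log_le_log (Real.rpow_pos_of_pos hP a) hPn
    simp only [hgt, max_eq_left hz]
  rw [hsum]
  exact key

/-- **The band is below every invisibility threshold:** for every fixed `ε > 0`, eventually in `D`,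
`P·(D·t₀) < P^{1+ε}` — i.e. the band `n ∈ (P, P·Dt₀] = (P, P^{1+α̃}]`
(`α̃ = log(Dt₀)/log P = 𝓛⁻⁸(1 + 519 log 𝓛/𝓛) → 0`) sits entirely BELOW the blocks `P^{1+ε} ≤ X` on which
`tailInvisible` / `tailInvisible_of_lipschitzOnWith` apply (`D·t₀ = e^𝓛·𝓛⁵¹⁹ ≤ e^{520𝓛} < e^{ε𝓛⁹}` once `𝓛 > 520/ε`).
[cite: Zhang2022LandauSiegel, §2 (2.6), (2.8), (2.30)] -/
theorem band_lt_rpow_one_add {ε : ℝ} (hε : 0 < ε) :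
    Skeleton.ForAllLarge fun D _ _ => Skeleton.bigP D * ((D : ℝ) * Skeleton.t0 D) < Skeleton.bigP D ^ (1 + ε) := by
  refine ForAllLarge.of_le ⌈Real.exp (max 1 (520 / ε + 1))⌉₊ ?_
  intro D _ χ hD _ _
  have hℓ : max 1 (520 / ε + 1) ≤ ell D := le_ell_of_ceil_exp_le'' hD
  have hℓ1 : 1 ≤ ell D := le_trans (le_max_left _ _) hℓ
  have hℓε : 520 / ε + 1 ≤ ell D := le_trans (le_max_right _ _) hℓ
  have hℓ0 : 0 < ell D := by linarith
  have hP : 0 < bigP D := Real.exp_pos _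
  have hDpos : (0 : ℝ) < D := by exact_mod_cast Nat.pos_of_ne_zero (NeZero.ne D)
  have hDexp : (D : ℝ) = Real.exp (ell D) := by rw [ell, Real.exp_log hDpos]
  -- `t₀ = 𝓛⁵¹⁹ ≤ e^{519𝓛}`
  have ht0 : t0 D ≤ Real.exp (519 * ell D) := by
    have h1 : ell D ≤ Real.exp (ell D) := by have := Real.add_one_le_exp (ell D); linarith
    calc t0 D = ell D ^ 519 := rfl
      _ ≤ Real.exp (ell D) ^ 519 := pow_le_pow_left₀ hℓ0.le h1 519
      _ = Real.exp (519 * ell D) := by rw [← Real.exp_nat_mul]; norm_num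
  -- `520𝓛 < ε𝓛⁹`
  have h8 : ell D ≤ ell D ^ 8 := by
    calc ell D = ell D ^ 1 := (pow_one _).symm
      _ ≤ ell D ^ 8 := pow_le_pow_right₀ hℓ1 (by norm_num)
  have hkey : 520 * ell D < ε * ell D ^ 9 := by
    have h520 : 520 / ε < ell D ^ 8 := by linarith
    have h520' : 520 < ε * ell D ^ 8 := by
      have := mul_lt_mul_of_pos_left h520 hε
      rwa [mul_div_cancel₀ _ hε.ne'] at this
    have : 520 * ell D < ε * ell D ^ 8 * ell D := by nlinarith
    calc 520 * ell D < ε * ell D ^ 8 * ell D := this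
      _ = ε * ell D ^ 9 := by ring
  -- assemble
  have hDt : (D : ℝ) * t0 D < bigP D ^ ε := by
    calc (D : ℝ) * t0 D ≤ Real.exp (ell D) * Real.exp (519 * ell D) := by
          rw [hDexp]; exact mul_le_mul_of_nonneg_left ht0 (Real.exp_pos _).le
      _ = Real.exp (520 * ell D) := by rw [← Real.exp_add]; ring_nf
      _ < Real.exp (ε * ell D ^ 9) := Real.exp_lt_exp.mpr hkey
      _ = bigP D ^ ε := by rw [bigP, ← Real.exp_mul]; ring_nf
  calc bigP D * ((D : ℝ) * t0 D) < bigP D * bigP D ^ ε := mul_lt_mul_of_pos_left hDt hP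
    _ = bigP D ^ (1 + ε) := by rw [Real.rpow_add hP, Real.rpow_one]

end Block

end Literature.NumberTheory.LFunctions.Zhang2022.KnifeEdgeInvisibleTail
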